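import Mathlib
import Summits.AtomisticToContinuum.FouriersLaw.Theorems.BondHeatUncertaintyPositiveOrInfiniteLimit
import Summits.AtomisticToContinuum.FouriersLaw.Theorems.OddSectorIrreversibilityBoundedResponseConvergesStubEscapeNonOscillationOfSuperadditive
import Summits.AtomisticToContinuum.FouriersLaw.Theorems.OddSectorIrreversibilityBoundedResponseConvergesSummableDefectFeketeBlocks

/-!
# Crux `BoundedResponseConverges` (stmt-AtomisticToContinuum-9141), line `escape-deficit-dichotomy` —
# Fekete with a SUMMABLE defect, part 2: the `EReal` limit and the resistance corollaries

Support file for item `stmt-AtomisticToContinuum-9141`. Continues `…SummableDefectFeketeBlocks.lean`: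

* `tendsto_div_nat_of_summable_dyadic` — `φ ≥ 0` non-decreasing with `∑ₖ φ(2ᵏ)/2ᵏ < ∞` forces `φ n / n → 0`;
* `dyadic_partial_sums_small` — the dyadic partial sums `Σ_{l<i} φ(2^{l+1}m)/(2^{l+1}m)` are uniformly `≤ ε`
  for all large bases `m`;
* `ereal_tendsto_div_of_summableDefect_subadditive` — **Fekete's lemma with a summable defect (de Bruijn–Erdős form)
  on `{n ≥ 2}`**: `b (n+m) ≤ b n + b m + φ (n+m)` ⇒ `↑(b n / n)` converges in `EReal` to a limit `< ⊤` (real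
  limit or `−∞`; no lower bound assumed) — the registered helper sub-goal of this file;
* `ereal_tendsto_of_summableDefect_subadditive_resistance` — `D N > 0` (`N ≥ 2`),
  `R (N+M) ≤ R N + R M + φ (N+M)` for `R N = (N−1)/D N` ⇒ `↑(D N) → ℓ' ∈ (0, ⊤]` (bounded-defect case: the landed
  `ereal_tendsto_of_quasiSubadditive_resistance`);
* `ereal_tendsto_of_summableDefect_superadditive_resistance` — `R N + R M − φ (N+M) ≤ R (N+M)` ⇒ `↑(D N)` converges
  in `EReal` (bounded-defect case: the landed `ereal_tendsto_of_superadditive_resistance`, p138689).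

The by-name consequences (slot 9128, floor 11749, the crux 9141, non-oscillation 12238) are in
`…SummableDefectSeriesLaw.lean`.

References: M. Fekete, Math. Z. 17 (1923) 228–249; N. G. de Bruijn and P. Erdős, *Some linear and some quadratic
recursion formulas II*, Indag. Math. 14 (1952) 152–163 (Thm. 22–23: subadditivity with an error term `φ`,
`∑ φ(n)/n² < ∞`).
-/

noncomputable section

namespace Summit.AtomisticToContinuum.FouriersLaw.Theorems.EscapeDeficitDichotomy

open Filter Topology Set
open Summit.AtomisticToContinuum.FouriersLaw.Theorems.PositiveOrInfiniteLimit

/-! ## Fekete's lemma with a summable defect (de Bruijn–Erdős) on the index semigroup `{n ≥ 2}` -/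

/-- If `φ ≥ 0` is non-decreasing and `k ↦ φ (2ᵏ) / 2ᵏ` is summable then `φ n / n → 0`
(`φ n / n ≤ 2 · φ (2^{k+1}) / 2^{k+1}` for `2ᵏ ≤ n < 2^{k+1}`, and the terms of a summable series tend to `0`).
[folklore] -/
theorem tendsto_div_nat_of_summable_dyadic {φ : ℕ → ℝ} (hφ0 : ∀ n, 0 ≤ φ n) (hφm : Monotone φ)
    (hφs : Summable fun k : ℕ => φ (2 ^ k) / ((2 ^ k : ℕ) : ℝ)) :
    Tendsto (fun n : ℕ => φ n / (n : ℝ)) atTop (𝓝 0) := by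
  have hc := hφs.tendsto_atTop_zero
  rw [Metric.tendsto_atTop] at hc ⊢
  intro ε hε
  obtain ⟨K, hK⟩ := hc (ε / 2) (half_pos hε)
  refine ⟨2 ^ K, fun n hn => ?_⟩
  have hn0 : 0 < n := lt_of_lt_of_le (Nat.two_pow_pos K) hn
  set k := Nat.log 2 n with hk
  have hnk : n < 2 ^ (k + 1) := Nat.lt_pow_succ_log_self (by norm_num) n
  have hkn : 2 ^ k ≤ n := Nat.pow_log_le_self 2 (by omega)
  have hKk : K ≤ k + 1 := by
    have : K ≤ k := by
      rw [hk]
      exact Nat.le_log_of_pow_le (by norm_num) hn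
    omega
  have hterm := hK (k + 1) hKk
  rw [Real.dist_eq, sub_zero] at hterm ⊢
  have hnpos : (0 : ℝ) < n := by exact_mod_cast hn0
  have hpow_pos : (0 : ℝ) < ((2 ^ (k + 1) : ℕ) : ℝ) := by exact_mod_cast Nat.two_pow_pos (k + 1)
  rw [abs_of_nonneg (div_nonneg (hφ0 n) hnpos.le)]
  rw [abs_of_nonneg (div_nonneg (hφ0 _) hpow_pos.le)] at hterm
  -- `φ n / n ≤ φ (2^{k+1}) / 2^k = 2 · (φ (2^{k+1}) / 2^{k+1})`
  have h1 : φ n ≤ φ (2 ^ (k + 1)) := hφm hnk.le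
  have h2 : ((2 ^ (k + 1) : ℕ) : ℝ) ≤ 2 * (n : ℝ) := by
    have : 2 ^ (k + 1) ≤ 2 * n := by
      have : 2 ^ (k + 1) = 2 * 2 ^ k := by ring
      omega
    exact_mod_cast this
  calc φ n / (n : ℝ) ≤ φ (2 ^ (k + 1)) / (n : ℝ) := div_le_div_of_nonneg_right h1 hnpos.le
    _ ≤ φ (2 ^ (k + 1)) / (((2 ^ (k + 1) : ℕ) : ℝ) / 2) := by
        apply div_le_div_of_nonneg_left (hφ0 _) (by positivity)
        linarith
    _ = 2 * (φ (2 ^ (k + 1)) / ((2 ^ (k + 1) : ℕ) : ℝ)) := by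
        field_simp
    _ < ε := by linarith

/-- The dyadic tails are uniformly small at large base: if `φ ≥ 0` is non-decreasing and `k ↦ φ (2ᵏ) / 2ᵏ` is
summable, then for every `ε > 0` there is `M` such that for all `m ≥ M` and all `i`,
`Σ_{l < i} φ (2^{l+1} m) / (2^{l+1} m) ≤ ε` (compare with twice the tail of the dyadic series beyond `log₂ m`).
[folklore] -/
theorem dyadic_partial_sums_small {φ : ℕ → ℝ} (hφ0 : ∀ n, 0 ≤ φ n) (hφm : Monotone φ)
    (hφs : Summable fun k : ℕ => φ (2 ^ k) / ((2 ^ k : ℕ) : ℝ)) {ε : ℝ} (hε : 0 < ε) :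
    ∃ M : ℕ, 2 ≤ M ∧ ∀ m : ℕ, M ≤ m → ∀ i : ℕ,
      ∑ l ∈ Finset.range i, φ (2 ^ (l + 1) * m) / ((2 ^ (l + 1) * m : ℕ) : ℝ) ≤ ε := by
  set c : ℕ → ℝ := fun k => φ (2 ^ k) / ((2 ^ k : ℕ) : ℝ) with hc_def
  have hc0 : ∀ k, 0 ≤ c k := fun k => div_nonneg (hφ0 _) (Nat.cast_nonneg _)
  -- tails of the dyadic series tend to `0`
  have htail : Tendsto (fun a : ℕ => ∑' k, c (k + a)) atTop (𝓝 0) := tendsto_sum_nat_add c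
  rw [Metric.tendsto_atTop] at htail
  obtain ⟨A₀, hA₀⟩ := htail (ε / 2) (half_pos hε)
  refine ⟨2 ^ (A₀ + 1), le_trans (by norm_num) (Nat.pow_le_pow_right (by norm_num) (Nat.succ_le_succ (Nat.zero_le _))),
    fun m hm i => ?_⟩
  have hm0 : 0 < m := lt_of_lt_of_le (Nat.two_pow_pos _) hm
  set a := Nat.log 2 m with ha
  have hma : m < 2 ^ (a + 1) := Nat.lt_pow_succ_log_self (by norm_num) m
  have ham : 2 ^ a ≤ m := Nat.pow_log_le_self 2 (by omega)
  have hA₀a : A₀ ≤ a + 2 := by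
    have : A₀ + 1 ≤ a := by
      rw [ha]
      exact Nat.le_log_of_pow_le (by norm_num) hm
    omega
  -- termwise comparison with the shifted dyadic series
  have hterm : ∀ l : ℕ, φ (2 ^ (l + 1) * m) / ((2 ^ (l + 1) * m : ℕ) : ℝ) ≤ 2 * c (l + (a + 2)) := by
    intro l
    have hnum : φ (2 ^ (l + 1) * m) ≤ φ (2 ^ (l + (a + 2))) := by
      apply hφm
      calc 2 ^ (l + 1) * m ≤ 2 ^ (l + 1) * 2 ^ (a + 1) := Nat.mul_le_mul_left _ hma.le
        _ = 2 ^ (l + (a + 2)) := by ring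
    have hden : ((2 ^ (l + (a + 2)) : ℕ) : ℝ) ≤ 2 * ((2 ^ (l + 1) * m : ℕ) : ℝ) := by
      have : 2 ^ (l + (a + 2)) ≤ 2 * (2 ^ (l + 1) * m) := by
        calc 2 ^ (l + (a + 2)) = 2 * (2 ^ (l + 1) * 2 ^ a) := by ring
          _ ≤ 2 * (2 ^ (l + 1) * m) := Nat.mul_le_mul_left 2 (Nat.mul_le_mul_left _ ham)
      exact_mod_cast this
    have hden_pos : (0 : ℝ) < ((2 ^ (l + 1) * m : ℕ) : ℝ) := by
      exact_mod_cast (show 0 < 2 ^ (l + 1) * m by positivity)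
    have hpow_pos : (0 : ℝ) < ((2 ^ (l + (a + 2)) : ℕ) : ℝ) := by exact_mod_cast Nat.two_pow_pos _
    simp only [hc_def]
    calc φ (2 ^ (l + 1) * m) / ((2 ^ (l + 1) * m : ℕ) : ℝ)
        ≤ φ (2 ^ (l + (a + 2))) / ((2 ^ (l + 1) * m : ℕ) : ℝ) := div_le_div_of_nonneg_right hnum hden_pos.le
      _ ≤ φ (2 ^ (l + (a + 2))) / (((2 ^ (l + (a + 2)) : ℕ) : ℝ) / 2) := by
          apply div_le_div_of_nonneg_left (hφ0 _) (by positivity)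
          linarith
      _ = 2 * (φ (2 ^ (l + (a + 2))) / ((2 ^ (l + (a + 2)) : ℕ) : ℝ)) := by
          field_simp
  have hsum_shift : Summable fun l : ℕ => c (l + (a + 2)) := (summable_nat_add_iff (a + 2)).2 hφs
  calc ∑ l ∈ Finset.range i, φ (2 ^ (l + 1) * m) / ((2 ^ (l + 1) * m : ℕ) : ℝ)
      ≤ ∑ l ∈ Finset.range i, 2 * c (l + (a + 2)) := Finset.sum_le_sum fun l _ => hterm l
    _ = 2 * ∑ l ∈ Finset.range i, c (l + (a + 2)) := by rw [Finset.mul_sum]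
    _ ≤ 2 * ∑' l, c (l + (a + 2)) := by
        refine mul_le_mul_of_nonneg_left ?_ (by norm_num)
        exact hsum_shift.sum_le_tsum (Finset.range i) (fun l _ => hc0 _)
    _ ≤ 2 * (ε / 2) := by
        refine mul_le_mul_of_nonneg_left ?_ (by norm_num)
        have h := hA₀ (a + 2) hA₀a
        rw [Real.dist_eq, sub_zero, abs_of_nonneg (tsum_nonneg fun l => hc0 _)] at h
        exact h.le
    _ = ε := by ring

/-- **Fekete's lemma with a summable defect (de Bruijn–Erdős form) on `{n ≥ 2}`.** If
`b (n+m) ≤ b n + b m + φ (n+m)` for all `n, m ≥ 2`, where `φ ≥ 0` is non-decreasing with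
`∑ₖ φ(2ᵏ)/2ᵏ < ∞`, then `↑(b n / n)` converges in `EReal` to a limit `ℓ < ⊤` — i.e. `b n / n` either converges
in `ℝ` or tends to `−∞` (the limit is `inf`-like; no lower bound on `b` is assumed). Proof: for every `ε > 0`
and every large base `m`, eventually `b n / n ≤ b m / m + 5ε` (`div_le_of_defect_subadditive`,
`dyadic_partial_sums_small`, `tendsto_div_nat_of_summable_dyadic`); choosing `m` along the `liminf` gives
`limsup ≤ liminf` in `EReal`. [folklore] (Fekete 1923; de Bruijn–Erdős 1952, Thm. 22–23) -/
theorem ereal_tendsto_div_of_summableDefect_subadditive : ∀ (b φ : ℕ → ℝ), (∀ n : ℕ, 0 ≤ φ n) → Monotone φ → Summable (fun k : ℕ => φ (2 ^ k) / ((2 ^ k : ℕ) : ℝ)) → (∀ n m : ℕ, 2 ≤ n → 2 ≤ m → b (n + m) ≤ b n + b m + φ (n + m)) → ∃ ℓ : EReal, ℓ < ⊤ ∧ Filter.Tendsto (fun n : ℕ => ((b n / (n : ℝ) : ℝ) : EReal)) Filter.atTop (nhds ℓ) := by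
  intro b φ hφ0 hφm hφs hb
  -- the key eventual bound: for every `ε > 0` there is `M ≥ 2` such that for every `m ≥ M`,
  -- eventually `b n / n ≤ b m / m + 5 ε`
  have key : ∀ ε : ℝ, 0 < ε → ∃ M : ℕ, 2 ≤ M ∧ ∀ m : ℕ, M ≤ m →
      ∀ᶠ n : ℕ in atTop, b n / (n : ℝ) ≤ b m / (m : ℝ) + 5 * ε := by
    intro ε hε
    obtain ⟨M, hM2, hM⟩ := dyadic_partial_sums_small hφ0 hφm hφs hε
    refine ⟨M, hM2, fun m hm => ?_⟩
    have hm2 : 2 ≤ m := hM2.trans hm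
    obtain ⟨C, hC⟩ := div_le_of_defect_subadditive b φ hφ0 hφm hb m hm2 ε (hM m hm)
    have h1 : ∀ᶠ n : ℕ in atTop, C / (n : ℝ) ≤ ε := by
      have := (tendsto_const_div_atTop_nhds_zero_nat C).eventually (ge_mem_nhds hε)
      exact this
    have h2 : ∀ᶠ n : ℕ in atTop, φ n / (n : ℝ) ≤ ε :=
      (tendsto_div_nat_of_summable_dyadic hφ0 hφm hφs).eventually (ge_mem_nhds hε)
    filter_upwards [h1, h2, eventually_ge_atTop (m + 2)] with n hn1 hn2 hn3
    linarith [hC n hn3]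
  -- `limsup ≤ liminf` for `u n := ↑(b n / n)`
  have hle : limsup (fun n : ℕ => ((b n / (n : ℝ) : ℝ) : EReal)) atTop ≤
      liminf (fun n : ℕ => ((b n / (n : ℝ) : ℝ) : EReal)) atTop := by
    by_contra hlt
    push Not at hlt
    obtain ⟨c, hc1, hc2⟩ := EReal.lt_iff_exists_real_btwn.1 hlt
    obtain ⟨d, hd1, hd2⟩ := EReal.lt_iff_exists_real_btwn.1 hc2
    have hcd : c < d := EReal.coe_lt_coe_iff.1 hd1
    obtain ⟨M, -, hM⟩ := key ((d - c) / 8) (by linarith)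
    -- a base `m ≥ M` below `c` (frequently, since `liminf < c`)
    have hfreq : ∃ᶠ m : ℕ in atTop, ((b m / (m : ℝ) : ℝ) : EReal) < (c : EReal) :=
      frequently_lt_of_liminf_lt (by isBoundedDefault) hc1
    obtain ⟨m, hmc, hmM⟩ := (hfreq.and_eventually (eventually_ge_atTop M)).exists
    have hbm : b m / (m : ℝ) < c := EReal.coe_lt_coe_iff.1 hmc
    have hev := hM m hmM
    -- hence eventually `u n < d`, contradicting `d < limsup u`
    have hev' : ∀ᶠ n : ℕ in atTop, ((b n / (n : ℝ) : ℝ) : EReal) < (d : EReal) := by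
      filter_upwards [hev] with n hn
      exact EReal.coe_lt_coe_iff.2 (by linarith)
    have hfreq' : ∃ᶠ n : ℕ in atTop, (d : EReal) < ((b n / (n : ℝ) : ℝ) : EReal) :=
      frequently_lt_of_lt_limsup (by isBoundedDefault) hd2
    obtain ⟨n, hn1, hn2⟩ := (hfreq'.and_eventually hev').exists
    exact lt_irrefl _ (hn1.trans hn2)
  have heq : liminf (fun n : ℕ => ((b n / (n : ℝ) : ℝ) : EReal)) atTop =
      limsup (fun n : ℕ => ((b n / (n : ℝ) : ℝ) : EReal)) atTop := le_antisymm liminf_le_limsup hle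
  refine ⟨limsup (fun n : ℕ => ((b n / (n : ℝ) : ℝ) : EReal)) atTop, ?_,
    tendsto_of_liminf_eq_limsup heq rfl⟩
  -- the limit is `< ⊤`: eventually `u n ≤ ↑K`
  obtain ⟨M, -, hM⟩ := key 1 one_pos
  have hev := hM M le_rfl
  have hK : limsup (fun n : ℕ => ((b n / (n : ℝ) : ℝ) : EReal)) atTop ≤
      ((b M / (M : ℝ) + 5 * 1 : ℝ) : EReal) := by
    refine limsup_le_of_le (by isBoundedDefault) ?_
    filter_upwards [hev] with n hn
    exact EReal.coe_le_coe_iff.2 hn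
  exact lt_of_le_of_lt hK (EReal.coe_lt_top _)

/-! ## Resistances with a summable junction defect -/

/-- **Subadditive series law with a summable defect ⇒ positive-or-infinite limit of the conductance.** For an
abstract sequence `D` with `D N > 0` (`N ≥ 2`) whose resistances `R N := (N−1)/D N` satisfy
`R (N+M) ≤ R N + R M + φ (N+M)` on `{N, M ≥ 2}` (`φ ≥ 0` non-decreasing, `∑ₖ φ(2ᵏ)/2ᵏ < ∞`), `↑(D N)` converges in
`EReal` to some `ℓ' > 0`: by the summable-defect Fekete lemma `R N / N → s ∈ [0, ∞)` (a REAL limit: the `EReal`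
limit is `< ⊤` and `≥ 0`), and the landed `ereal_tendsto_of_tendsto_resistance_div` concludes (`s = 0` is the
`⊤` branch). The bounded-defect case `φ ≡ C` is the landed `ereal_tendsto_of_quasiSubadditive_resistance`.
[folklore] -/
theorem ereal_tendsto_of_summableDefect_subadditive_resistance (D φ : ℕ → ℝ) (hφ0 : ∀ n, 0 ≤ φ n)
    (hφm : Monotone φ) (hφs : Summable fun k : ℕ => φ (2 ^ k) / ((2 ^ k : ℕ) : ℝ))
    (hpos : ∀ N : ℕ, 2 ≤ N → 0 < D N)
    (hsub : ∀ N M : ℕ, 2 ≤ N → 2 ≤ M →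
      ((N : ℝ) + (M : ℝ) - 1) / D (N + M) ≤ ((N : ℝ) - 1) / D N + ((M : ℝ) - 1) / D M + φ (N + M)) :
    ∃ ℓ : EReal, 0 < ℓ ∧ Tendsto (fun N : ℕ => ((D N : ℝ) : EReal)) atTop (𝓝 ℓ) := by
  set R : ℕ → ℝ := fun N => ((N : ℝ) - 1) / D N with hR_def
  have hR : ∀ n m : ℕ, 2 ≤ n → 2 ≤ m → R (n + m) ≤ R n + R m + φ (n + m) := by
    intro n m hn hm
    have h := hsub n m hn hm
    simp only [hR_def, Nat.cast_add]
    exact h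
  obtain ⟨ℓ, hℓtop, hℓ⟩ := ereal_tendsto_div_of_summableDefect_subadditive R φ hφ0 hφm hφs hR
  -- `R N / N ≥ 0` for `N ≥ 2`, so `ℓ ≥ 0` is a real number `s`
  have hRnn : ∀ N : ℕ, 2 ≤ N → 0 ≤ R N / (N : ℝ) := by
    intro N hN
    have hN1 : (0 : ℝ) ≤ (N : ℝ) - 1 := by
      have : (2 : ℝ) ≤ N := by exact_mod_cast hN
      linarith
    exact div_nonneg (div_nonneg hN1 (hpos N hN).le) (Nat.cast_nonneg N)
  have hℓ0 : (0 : EReal) ≤ ℓ :=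
    ge_of_tendsto hℓ <| by
      filter_upwards [eventually_ge_atTop 2] with N hN
      exact_mod_cast hRnn N hN
  have hℓbot : ℓ ≠ ⊥ := ne_bot_of_le_ne_bot EReal.zero_ne_bot hℓ0
  have hℓtop' : ℓ ≠ ⊤ := hℓtop.ne
  have hs : Tendsto (fun N : ℕ => R N / (N : ℝ)) atTop (𝓝 ℓ.toReal) := by
    rw [← EReal.coe_toReal hℓtop' hℓbot] at hℓ
    exact EReal.tendsto_coe.1 hℓ
  have hs0 : 0 ≤ ℓ.toReal := by
    have h := hℓ0
    rw [← EReal.coe_toReal hℓtop' hℓbot] at h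
    exact_mod_cast h
  exact ereal_tendsto_of_tendsto_resistance_div D hpos hs0 hs

/-- **Superadditive series law with a summable defect ⇒ the conductance is `EReal`-regular.** For an abstract
sequence `D` with `D N > 0` (`N ≥ 2`) and `R N + R M − φ (N+M) ≤ R (N+M)` on `{N, M ≥ 2}` (`φ ≥ 0` non-decreasing,
`∑ₖ φ(2ᵏ)/2ᵏ < ∞`), `↑(D N)` converges in `EReal` (to `0` if `R N / N → +∞`, to `1/s` or `⊤` otherwise): apply the
summable-defect Fekete lemma to the subadditive sequence `−R N`. The bounded-defect case is the landed
`ereal_tendsto_of_superadditive_resistance` (p138689). [folklore] -/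
theorem ereal_tendsto_of_summableDefect_superadditive_resistance (D φ : ℕ → ℝ) (hφ0 : ∀ n, 0 ≤ φ n)
    (hφm : Monotone φ) (hφs : Summable fun k : ℕ => φ (2 ^ k) / ((2 ^ k : ℕ) : ℝ))
    (hpos : ∀ N : ℕ, 2 ≤ N → 0 < D N)
    (hsup : ∀ N M : ℕ, 2 ≤ N → 2 ≤ M →
      ((N : ℝ) - 1) / D N + ((M : ℝ) - 1) / D M - φ (N + M) ≤ ((N : ℝ) + (M : ℝ) - 1) / D (N + M)) :
    ∃ ℓ : EReal, Tendsto (fun N : ℕ => ((D N : ℝ) : EReal)) atTop (𝓝 ℓ) := by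
  set R : ℕ → ℝ := fun N => ((N : ℝ) - 1) / D N with hR_def
  -- `u N := -R N` is defect-subadditive
  set u : ℕ → ℝ := fun N => -R N with hu_def
  have hu : ∀ n m : ℕ, 2 ≤ n → 2 ≤ m → u (n + m) ≤ u n + u m + φ (n + m) := by
    intro n m hn hm
    have h := hsup n m hn hm
    simp only [hu_def, hR_def, Nat.cast_add]
    linarith
  have hRnn : ∀ N : ℕ, 2 ≤ N → 0 ≤ R N / (N : ℝ) := by
    intro N hN
    have hN1 : (0 : ℝ) ≤ (N : ℝ) - 1 := by
      have : (2 : ℝ) ≤ N := by exact_mod_cast hN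
      linarith
    exact div_nonneg (div_nonneg hN1 (hpos N hN).le) (Nat.cast_nonneg N)
  obtain ⟨ℓ, -, hℓ⟩ := ereal_tendsto_div_of_summableDefect_subadditive u φ hφ0 hφm hφs hu
  by_cases hbot : ℓ = ⊥
  · -- `u N / N → -∞`, i.e. `R N / N → +∞`: then `D N → 0`
    rw [hbot] at hℓ
    have hRtop : Tendsto (fun N : ℕ => R N / (N : ℝ)) atTop atTop := by
      rw [tendsto_atTop]
      intro B
      have h := (EReal.tendsto_nhds_bot_iff_real.1 hℓ) (-B)
      filter_upwards [h] with N hN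
      have hN' : u N / (N : ℝ) < -B := EReal.coe_lt_coe_iff.1 hN
      simp only [hu_def, neg_div] at hN'
      linarith
    have hDle : ∀ N : ℕ, 2 ≤ N → D N ≤ (R N / (N : ℝ))⁻¹ := by
      intro N hN
      have hD := hpos N hN
      have hN1 : (0 : ℝ) < (N : ℝ) - 1 := by
        have : (2 : ℝ) ≤ N := by exact_mod_cast hN
        linarith
      have hRN : R N / (N : ℝ) = ((N : ℝ) - 1) / (D N * (N : ℝ)) := by
        simp only [hR_def]
        rw [div_div]
      rw [hRN, inv_div, le_div_iff₀ hN1]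
      nlinarith
    have hinv : Tendsto (fun N : ℕ => (R N / (N : ℝ))⁻¹) atTop (𝓝 0) := tendsto_inv_atTop_zero.comp hRtop
    have hD0 : Tendsto D atTop (𝓝 0) := by
      refine tendsto_of_tendsto_of_tendsto_of_le_of_le' tendsto_const_nhds hinv ?_ ?_
      · filter_upwards [eventually_ge_atTop 2] with N hN
        exact (hpos N hN).le
      · filter_upwards [eventually_ge_atTop 2] with N hN
        exact hDle N hN
    exact ⟨((0 : ℝ) : EReal), (continuous_coe_real_ereal.tendsto 0).comp hD0⟩
  · -- real Fekete limit `t ≤ 0` of `u N / N`: `R N / N → -t =: s ≥ 0`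
    have htop : ℓ ≠ ⊤ := by
      have h0 : ℓ ≤ (0 : EReal) :=
        le_of_tendsto hℓ <| by
          filter_upwards [eventually_ge_atTop 2] with N hN
          have : u N / (N : ℝ) ≤ 0 := by
            simp only [hu_def, neg_div]
            linarith [hRnn N hN]
          exact_mod_cast this
      exact ne_top_of_le_ne_top EReal.zero_ne_top h0
    have ht : Tendsto (fun N : ℕ => u N / (N : ℝ)) atTop (𝓝 ℓ.toReal) := by
      rw [← EReal.coe_toReal htop hbot] at hℓ
      exact EReal.tendsto_coe.1 hℓ
    have hs : Tendsto (fun N : ℕ => ((N : ℝ) - 1) / D N / (N : ℝ)) atTop (𝓝 (-ℓ.toReal)) := by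
      refine ht.neg.congr' ?_
      filter_upwards with N
      simp only [hu_def, hR_def, neg_div, neg_neg]
    have hs0 : 0 ≤ -ℓ.toReal :=
      ge_of_tendsto hs <| by
        filter_upwards [eventually_ge_atTop 2] with N hN
        exact hRnn N hN
    obtain ⟨ℓ', -, hℓ'⟩ := ereal_tendsto_of_tendsto_resistance_div D hpos hs0 hs
    exact ⟨ℓ', hℓ'⟩


end Summit.AtomisticToContinuum.FouriersLaw.Theorems.EscapeDeficitDichotomy

end
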